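import Summits.RiemannHypothesis.RiemannHypothesis.Theorems.Splittings.BombieriTruncExactness

/-!
# Splittings — x-wuc (xiv-d1): Taylor data at a carrier and the CLUMP SCREENING THEOREM (T6b′) for Bombieri's truncations

Cell rh-split, seat rh-split-x-wuc g6/g7 (brief sha16 f79c5f09d8bcb036), card `run/shared/lean/pub/rh-split/cards/SPLIT-x-wuc.md`
§12–§13 (scratch of record `HOME/rh-split-x-wuc/SplitXWucG7b.lean` sha16 d0583c86bc2d8ec7: farm `lean check` rc 0 · 0 sorry · 0 warning,
standard axioms; referee replays: see the card).  Carved VERBATIM from that scratch by `HOME/rh-split-x-wuc/cut7/make_cut7.py`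
(cut (xiv-d), deltas listed in `cut7/CUT7.md`); sections as numbered there.
* G6.1 linear-combination calculus for `F` and `pairing`; G6.2 class vectors of two DIFFERENT right-half classes are pairing-orthogonal;
* G6.3 Taylor data at a carrier `t₀` (`wOf`, `tcoeff`, `rem`, `tailConst`, the weighted Taylor map and its non-trivial kernel when `d < #S`);
* G6.4 **(T6b′) `clump_negRoot`**: `d+1` distinct off-line zeros right of the line, multiplicity `≤ M`, `|ρ − ½ − it₀| ≤ 1`, present at level `N`
  ⟹ `𝒦_{[−1,1]}(Γ_N)` has a real eigenvalue in `(−c,0)` for every `c > 4·#S·M·ε_d²`.  UNCONDITIONAL (no RH / FOZ / SZC / named fact).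
HONEST LABEL: «SPLITTING SEARCH over kernel-typed RH-EQUIVALENCES; a splitting A ∧ B ⟹ RH is CONDITIONAL bookkeeping
unless A and B are both proved; nothing here bears on the truth of RH.»
-/

set_option linter.dupNamespace false

noncomputable section

open scoped Classical ComplexConjugate
open Set Filter Topology Complex MeasureTheory

namespace Summit.RiemannHypothesis.RiemannHypothesis.Theorems.Splittings.BombieriTruncClump

open Literature.NumberTheory.LFunctions Literature.NumberTheory.LFunctions.Bombieri2000
open Summit.RiemannHypothesis.RiemannHypothesis.Theses.RuelleBand
open Summit.RiemannHypothesis.RiemannHypothesis.Theorems.Splittings.BombieriTruncEigen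
open Summit.RiemannHypothesis.RiemannHypothesis.Theorems.Splittings.BombieriFozNoDep
open Summit.RiemannHypothesis.RiemannHypothesis.Theorems.Splittings.BombieriTruncGram
open Summit.RiemannHypothesis.RiemannHypothesis.Theorems.Splittings.BombieriTruncPairing
open Summit.RiemannHypothesis.RiemannHypothesis.Theorems.Splittings.BombieriTruncScreening
open Summit.RiemannHypothesis.RiemannHypothesis.Theorems.Splittings.BombieriTruncBandGap
open Summit.RiemannHypothesis.RiemannHypothesis.Theorems.Splittings.BombieriTruncMultiplicity
open Summit.RiemannHypothesis.RiemannHypothesis.Theorems.Splittings.BombieriTruncEventualStrip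
open Summit.RiemannHypothesis.RiemannHypothesis.Theorems.Splittings.BombieriTruncExactness

variable {N : ℕ}

/-! ### G6.1 Linear-combination calculus -/

/-- `F` of a finite linear combination of vectors is the same combination of their `F`-transforms. -/
theorem F_finset_sum {ι : Type*} (S : Finset ι) (c : ι → ℂ) (v : ι → truncIdx N → ℂ) (u : ℝ) :
    F N (∑ j ∈ S, c j • v j) u = ∑ j ∈ S, c j * F N (v j) u := by
  simp only [F, Finset.sum_apply, Pi.smul_apply, smul_eq_mul, Finset.sum_mul, Finset.mul_sum]
  rw [Finset.sum_comm]
  refine Finset.sum_congr rfl fun j _ ↦ Finset.sum_congr rfl fun l _ ↦ ?_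
  ring

/-- The self-pairing of a finite linear combination expands as the double sum of the pairwise pairings. -/
theorem pairing_finset_sum {ι : Type*} (S : Finset ι) (c : ι → ℂ) (v : ι → truncIdx N → ℂ) :
    pairing N (∑ j ∈ S, c j • v j) (∑ j ∈ S, c j • v j) =
      ∑ j ∈ S, ∑ l ∈ S, conj (c j) * c l * pairing N (v j) (v l) := by
  calc pairing N (∑ j ∈ S, c j • v j) (∑ j ∈ S, c j • v j)
      = ∑ s : truncIdx N, ∑ j ∈ S, ∑ l ∈ S, conj (c j) * c l * (conj (v j s) * v l (tbar s)) := by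
        unfold pairing
        refine Finset.sum_congr rfl fun s _ ↦ ?_
        rw [Finset.sum_apply, Finset.sum_apply, map_sum, Finset.sum_mul_sum]
        refine Finset.sum_congr rfl fun j _ ↦ Finset.sum_congr rfl fun l _ ↦ ?_
        simp only [Pi.smul_apply, smul_eq_mul, map_mul]
        ring
    _ = ∑ j ∈ S, ∑ l ∈ S, conj (c j) * c l * pairing N (v j) (v l) := by
        rw [Finset.sum_comm]
        refine Finset.sum_congr rfl fun j _ ↦ ?_
        rw [Finset.sum_comm]
        refine Finset.sum_congr rfl fun l _ ↦ ?_
        rw [pairing, Finset.mul_sum]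

/-! ### G6.2 Different right-half classes are pairing-orthogonal -/

/-- The zero carried by the mirror slot `tbar s` is `1 − conj ρ_s`. -/
theorem val_tbar (s : truncIdx N) :
    ((tbar s : truncIdx N) : ZeroIdx).val = 1 - conj ((s : ZeroIdx).val) := by
  rw [coe_tbar, ZeroIdx.val_bar]

/-- Real part of the mirror slot: `Re ρ_{tbar s} = 1 − Re ρ_s`. -/
theorem re_val_tbar (s : truncIdx N) :
    ((tbar s : truncIdx N) : ZeroIdx).val.re = 1 - (s : ZeroIdx).val.re := by
  rw [val_tbar]; simp

/-- Class vectors of two slots RIGHT of the line carrying DIFFERENT zeros are `pairing`-orthogonal: the class of `l` meets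
neither the class of `j` nor its mirror. -/
theorem pairing_classVec_classVec_eq_zero {j l : truncIdx N} (hj : 1 / 2 < (j : ZeroIdx).val.re)
    (hl : 1 / 2 < (l : ZeroIdx).val.re) (hne : (j : ZeroIdx).val ≠ (l : ZeroIdx).val) :
    pairing N (classVec j) (classVec l) = 0 := by
  unfold pairing
  refine Finset.sum_eq_zero fun s _ ↦ ?_
  by_cases h1 : s ∈ fib j
  · have hs : (s : ZeroIdx).val = (j : ZeroIdx).val := mem_fib.1 h1
    have ha : tbar s ∉ fib l := by
      intro h
      have h' := congrArg Complex.re (mem_fib.1 h)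
      rw [re_val_tbar, hs] at h'
      linarith
    have hb : tbar s ∉ fib (tbar l) := fun h ↦ hne (hs.symm.trans (mem_fib.1 (tbar_mem_fib_iff.1 h)))
    simp [classVec, ha, hb]
  · by_cases h2 : s ∈ fib (tbar j)
    · have hs : (s : ZeroIdx).val = 1 - conj ((j : ZeroIdx).val) := by rw [mem_fib.1 h2, val_tbar]
      have ha : tbar s ∉ fib l := by
        intro h
        have h' := mem_fib.1 h
        rw [val_tbar, hs] at h'
        simp only [map_sub, map_one, Complex.conj_conj, sub_sub_cancel] at h'
        exact hne h'
      have hb : tbar s ∉ fib (tbar l) := by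
        intro h
        have h' := congrArg Complex.re (mem_fib.1 (tbar_mem_fib_iff.1 h))
        rw [hs] at h'
        simp at h'
        linarith
      simp [classVec, ha, hb]
    · simp [classVec, h1, h2]

/-! ### G6.3 Taylor data at a carrier `t₀` -/

/-- `w_j(t₀) := ρ_j − ½ − i t₀`: the exponent of the slot `j` seen from the carrier frequency `t₀`. -/
def wOf (t₀ : ℝ) (j : truncIdx N) : ℂ := (j : ZeroIdx).val - 1 / 2 - I * t₀

/-- Taylor coefficients of `e^{−w u} − e^{w̄ u}`: `((−w)^m − w̄^m)/m!`. -/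
def tcoeff (t₀ : ℝ) (j : truncIdx N) (m : ℕ) : ℂ :=
  ((-wOf t₀ j) ^ m - (conj (wOf t₀ j)) ^ m) / m.factorial

/-- The Taylor tail constant `ε_d := (d+1)/(d!·d)` of `Complex.exp_bound`. -/
def tailConst (d : ℕ) : ℝ := ((d.succ : ℕ) : ℝ) * (((d.factorial : ℕ) : ℝ) * d)⁻¹

/-- The Taylor tail constant is non-negative. -/
theorem tailConst_nonneg (d : ℕ) : 0 ≤ tailConst d := by
  unfold tailConst; positivity

/-- The two Taylor remainders of `e^{−w u} − e^{w̄ u}` (degree `< d` removed). -/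
def rem (t₀ : ℝ) (d : ℕ) (j : truncIdx N) (u : ℝ) : ℂ :=
  (cexp (-(wOf t₀ j * u)) - ∑ m ∈ Finset.range d, (-(wOf t₀ j * u)) ^ m / m.factorial)
    - (cexp (conj (wOf t₀ j) * u) - ∑ m ∈ Finset.range d, (conj (wOf t₀ j) * u) ^ m / m.factorial)

/-- `F` of the mirror-pair vector at `j`: `e^{−(ρ_j − ½)u} − e^{conj(ρ_j − ½)u}`. -/
theorem F_pairVec_eq (j : truncIdx N) (u : ℝ) :
    F N (pairVec j) u =
      cexp (-(((j : ZeroIdx).val - 1 / 2) * u)) - cexp (conj ((j : ZeroIdx).val - 1 / 2) * u) := by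
  rw [pairVec, F_sub, F_single, F_single, I_mul_gamma ((j : truncIdx N) : ZeroIdx), I_mul_gamma_tbar j,
    neg_mul, neg_neg]

/-- The pair function with the carrier `e^{−i t₀ u}` factored out. -/
theorem F_pairVec_carrier (j : truncIdx N) (t₀ u : ℝ) :
    F N (pairVec j) u = cexp (-(I * t₀ * u)) * (cexp (-(wOf t₀ j * u)) - cexp (conj (wOf t₀ j) * u)) := by
  rw [F_pairVec_eq, mul_sub, ← Complex.exp_add, ← Complex.exp_add, wOf]
  congr 1
  · congr 1
    ring
  · congr 1
    simp only [map_sub, map_mul, Complex.conj_I, Complex.conj_ofReal, map_one, map_div₀, map_ofNat]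
    ring

/-- The difference of the two Taylor polynomials regrouped by powers of `u` with the coefficients `tcoeff`. -/
theorem taylor_poly_eq (t₀ : ℝ) (j : truncIdx N) (u : ℝ) (d : ℕ) :
    ∑ m ∈ Finset.range d, (-(wOf t₀ j * u)) ^ m / m.factorial
      - ∑ m ∈ Finset.range d, (conj (wOf t₀ j) * u) ^ m / m.factorial
      = ∑ m ∈ Finset.range d, (u : ℂ) ^ m * tcoeff t₀ j m := by
  rw [← Finset.sum_sub_distrib]
  refine Finset.sum_congr rfl fun m _ ↦ ?_
  rw [tcoeff, ← neg_mul, mul_pow, mul_pow]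
  ring

/-- `e^{−w u} − e^{w̄ u}` = remainder `rem` + the Taylor polynomial with coefficients `tcoeff`. -/
theorem exp_sub_exp_eq (t₀ : ℝ) (d : ℕ) (j : truncIdx N) (u : ℝ) :
    cexp (-(wOf t₀ j * u)) - cexp (conj (wOf t₀ j) * u)
      = rem t₀ d j u + ∑ m ∈ Finset.range d, (u : ℂ) ^ m * tcoeff t₀ j m := by
  rw [← taylor_poly_eq, rem]
  ring

/-- Taylor remainder of `cexp` on the unit disc: `‖e^x − Σ_{m<d} x^m/m!‖ ≤ tailConst d` for `‖x‖ ≤ 1`. -/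
theorem norm_exp_sub_taylor_le {x : ℂ} (hx : ‖x‖ ≤ 1) {d : ℕ} (hd : 0 < d) :
    ‖cexp x - ∑ m ∈ Finset.range d, x ^ m / m.factorial‖ ≤ tailConst d := by
  calc ‖cexp x - ∑ m ∈ Finset.range d, x ^ m / m.factorial‖ ≤ ‖x‖ ^ d * tailConst d :=
        Complex.exp_bound hx hd
    _ ≤ 1 * tailConst d :=
        mul_le_mul_of_nonneg_right (pow_le_one₀ (norm_nonneg _) hx) (tailConst_nonneg d)
    _ = tailConst d := one_mul _

/-- The two-sided remainder `rem` is at most `2·tailConst d` when `‖w‖ ≤ 1` and `|u| ≤ 1`. -/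
theorem norm_rem_le {t₀ : ℝ} {d : ℕ} (hd : 0 < d) {j : truncIdx N} (hw : ‖wOf t₀ j‖ ≤ 1) {u : ℝ}
    (hu : |u| ≤ 1) : ‖rem t₀ d j u‖ ≤ 2 * tailConst d := by
  have hwu : ‖wOf t₀ j‖ * |u| ≤ 1 := by
    calc ‖wOf t₀ j‖ * |u| ≤ 1 * 1 := mul_le_mul hw hu (abs_nonneg u) zero_le_one
      _ = 1 := one_mul 1
  have hx1 : ‖-(wOf t₀ j * u)‖ ≤ 1 := by
    rwa [norm_neg, norm_mul, Complex.norm_real, Real.norm_eq_abs]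
  have hx2 : ‖conj (wOf t₀ j) * u‖ ≤ 1 := by
    rwa [norm_mul, Complex.norm_conj, Complex.norm_real, Real.norm_eq_abs]
  calc ‖rem t₀ d j u‖
      ≤ ‖cexp (-(wOf t₀ j * u)) - ∑ m ∈ Finset.range d, (-(wOf t₀ j * u)) ^ m / m.factorial‖
        + ‖cexp (conj (wOf t₀ j) * u) - ∑ m ∈ Finset.range d, (conj (wOf t₀ j) * u) ^ m / m.factorial‖ :=
        norm_sub_le _ _
    _ ≤ tailConst d + tailConst d := add_le_add (norm_exp_sub_taylor_le hx1 hd) (norm_exp_sub_taylor_le hx2 hd)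
    _ = 2 * tailConst d := by ring

/-- The WEIGHTED Taylor map `B ↦ (Σ_j B_j · m_j · tcoeff_j(m))_{m<d}` on amplitude vectors over a finite slot set `S`
(`m_j = #fib j`, the multiplicity of the class of `j` present at level `N`). -/
def taylorMap (S : Finset (truncIdx N)) (t₀ : ℝ) (d : ℕ) : (S → ℂ) →ₗ[ℂ] (Fin d → ℂ) where
  toFun B m := ∑ j : S, B j * (fib (j : truncIdx N)).card * tcoeff t₀ (j : truncIdx N) m
  map_add' B C := by
    ext m
    simp only [Pi.add_apply, add_mul, Finset.sum_add_distrib]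
  map_smul' κ B := by
    ext m
    simp only [Pi.smul_apply, smul_eq_mul, RingHom.id_apply, Finset.mul_sum, mul_assoc]

/-- Rank–nullity: more slots than Taylor constraints ⟹ a non-trivial amplitude vector killing all `d` coefficients. -/
theorem exists_ker_taylorMap (S : Finset (truncIdx N)) (t₀ : ℝ) {d : ℕ} (hS : d < S.card) :
    ∃ B : S → ℂ, B ≠ 0 ∧
      ∀ m : Fin d, ∑ j : S, B j * (fib (j : truncIdx N)).card * tcoeff t₀ (j : truncIdx N) m = 0 := by
  have h : Module.finrank ℂ (Fin d → ℂ) < Module.finrank ℂ (S → ℂ) := by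
    rw [Module.finrank_fin_fun, Module.finrank_pi, Fintype.card_coe]
    exact hS
  obtain ⟨B, hB, hB0⟩ :=
    (Submodule.ne_bot_iff _).1 (LinearMap.ker_ne_bot_of_finrank_lt (f := taylorMap S t₀ d) h)
  refine ⟨B, hB0, fun m ↦ ?_⟩
  have h' := congrFun (LinearMap.mem_ker.1 hB) m
  simpa [taylorMap] using h'

/-- In the kernel of the Taylor map the degree-`< d` part of the synthesised function vanishes identically. -/
theorem sum_poly_eq_zero {S : Finset (truncIdx N)} {t₀ : ℝ} {d : ℕ} {C : S → ℂ}
    (hC : ∀ m : Fin d, ∑ j : S, C j * tcoeff t₀ (j : truncIdx N) m = 0) (u : ℝ) :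
    ∑ j : S, C j * ∑ m ∈ Finset.range d, (u : ℂ) ^ m * tcoeff t₀ (j : truncIdx N) m = 0 := by
  calc ∑ j : S, C j * ∑ m ∈ Finset.range d, (u : ℂ) ^ m * tcoeff t₀ (j : truncIdx N) m
      = ∑ m ∈ Finset.range d, (u : ℂ) ^ m * ∑ j : S, C j * tcoeff t₀ (j : truncIdx N) m := by
        simp only [Finset.mul_sum]
        rw [Finset.sum_comm]
        refine Finset.sum_congr rfl fun m _ ↦ Finset.sum_congr rfl fun j _ ↦ ?_
        ring
    _ = 0 := by
        rw [Finset.sum_range]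
        simp only [hC, mul_zero, Finset.sum_const_zero]

/-- **Pointwise smallness.** If the amplitudes `C` kill the first `d` Taylor coefficients and every `|w_j| ≤ 1`, then on `|u| ≤ 1`
the synthesised function `Σ_j C_j (e^{−z_j u} − e^{z̄_j u})` is bounded by `2 ε_d Σ_j |C_j|`. -/
theorem norm_sum_F_pairVec_le {S : Finset (truncIdx N)} {t₀ : ℝ} {d : ℕ} (hd : 0 < d) {C : S → ℂ}
    (hC : ∀ m : Fin d, ∑ j : S, C j * tcoeff t₀ (j : truncIdx N) m = 0)
    (hw : ∀ j : S, ‖wOf t₀ (j : truncIdx N)‖ ≤ 1) {u : ℝ} (hu : |u| ≤ 1) :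
    ‖∑ j : S, C j * F N (pairVec (j : truncIdx N)) u‖ ≤ 2 * tailConst d * ∑ j : S, ‖C j‖ := by
  have key : ∑ j : S, C j * F N (pairVec (j : truncIdx N)) u =
      cexp (-(I * t₀ * u)) * ∑ j : S, C j * rem t₀ d (j : truncIdx N) u := by
    calc ∑ j : S, C j * F N (pairVec (j : truncIdx N)) u
        = ∑ j : S, cexp (-(I * t₀ * u)) *
            (C j * (cexp (-(wOf t₀ (j : truncIdx N) * u)) - cexp (conj (wOf t₀ (j : truncIdx N)) * u))) := by
          refine Finset.sum_congr rfl fun j _ ↦ ?_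
          rw [F_pairVec_carrier (j : truncIdx N) t₀ u]
          ring
      _ = cexp (-(I * t₀ * u)) * (∑ j : S, C j * rem t₀ d (j : truncIdx N) u
            + ∑ j : S, C j * ∑ m ∈ Finset.range d, (u : ℂ) ^ m * tcoeff t₀ (j : truncIdx N) m) := by
          rw [← Finset.mul_sum, ← Finset.sum_add_distrib]
          congr 1
          refine Finset.sum_congr rfl fun j _ ↦ ?_
          rw [exp_sub_exp_eq t₀ d]
          ring
      _ = cexp (-(I * t₀ * u)) * ∑ j : S, C j * rem t₀ d (j : truncIdx N) u := by
          rw [sum_poly_eq_zero hC, add_zero]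
  have hexp : ‖cexp (-(I * t₀ * u))‖ = 1 := by
    have h1 : -(I * (t₀ : ℂ) * u) = ((-(t₀ * u) : ℝ) : ℂ) * I := by
      push_cast
      ring
    rw [h1, Complex.norm_exp_ofReal_mul_I]
  rw [key, norm_mul, hexp, one_mul]
  calc ‖∑ j : S, C j * rem t₀ d (j : truncIdx N) u‖ ≤ ∑ j : S, ‖C j * rem t₀ d (j : truncIdx N) u‖ :=
        norm_sum_le _ _
    _ ≤ ∑ j : S, ‖C j‖ * (2 * tailConst d) := Finset.sum_le_sum fun j _ ↦ by
        rw [norm_mul]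
        exact mul_le_mul_of_nonneg_left (norm_rem_le hd (hw j) hu) (norm_nonneg _)
    _ = 2 * tailConst d * ∑ j : S, ‖C j‖ := by
        rw [← Finset.sum_mul]
        ring

/-- Gram cost on `[−1,1]` of any vector whose synthesised function is such a combination: `≤ 8 ε_d² (Σ_j |C_j|)²`. -/
theorem cost_le_of_taylor {S : Finset (truncIdx N)} {t₀ : ℝ} {d : ℕ} (hd : 0 < d) {C : S → ℂ}
    (hC : ∀ m : Fin d, ∑ j : S, C j * tcoeff t₀ (j : truncIdx N) m = 0)
    (hw : ∀ j : S, ‖wOf t₀ (j : truncIdx N)‖ ≤ 1) {x : truncIdx N → ℂ}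
    (hx : ∀ u, F N x u = ∑ j : S, C j * F N (pairVec (j : truncIdx N)) u) :
    ∫ u in Icc (-1 : ℝ) 1, ‖F N x u‖ ^ 2 ≤ 8 * tailConst d ^ 2 * (∑ j : S, ‖C j‖) ^ 2 := by
  have hfin : volume (Icc (-1 : ℝ) 1) < ⊤ := measure_Icc_lt_top
  have h := norm_setIntegral_le_of_norm_le_const hfin (f := fun u ↦ ‖F N x u‖ ^ 2)
    (C := (2 * tailConst d * ∑ j : S, ‖C j‖) ^ 2) fun u hu ↦ by
      rw [Real.norm_of_nonneg (by positivity)]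
      have hu' : |u| ≤ 1 := abs_le.2 ⟨hu.1, hu.2⟩
      have hb := norm_sum_F_pairVec_le hd hC hw hu'
      rw [← hx u] at hb
      exact pow_le_pow_left₀ (norm_nonneg _) hb 2
  have h0 : 0 ≤ ∫ u in Icc (-1 : ℝ) 1, ‖F N x u‖ ^ 2 := integral_nonneg fun u ↦ by positivity
  rw [Real.norm_of_nonneg h0] at h
  have hvol : volume.real (Icc (-1 : ℝ) 1) = 2 := by
    rw [measureReal_def, Real.volume_Icc, ENNReal.toReal_ofReal (by norm_num)]
    norm_num
  rw [hvol] at h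
  calc ∫ u in Icc (-1 : ℝ) 1, ‖F N x u‖ ^ 2 ≤ (2 * tailConst d * ∑ j : S, ‖C j‖) ^ 2 * 2 := h
    _ = 8 * tailConst d ^ 2 * (∑ j : S, ‖C j‖) ^ 2 := by ring

/-! ### G6.4 The clump vector and the CLUMP SCREENING THEOREM (T6b′) -/

/-- The clump vector with amplitudes `B` on the classes of the slots of `S`: `Σ_{j∈S} B_j · classVec j`. -/
def clumpVec (S : Finset (truncIdx N)) (B : S → ℂ) : truncIdx N → ℂ :=
  ∑ j : S, B j • classVec (j : truncIdx N)

/-- The clump vector lies in the class-constant subspace `classSub N`. -/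
theorem clumpVec_mem (S : Finset (truncIdx N)) (B : S → ℂ) : clumpVec S B ∈ classSub N :=
  Submodule.sum_mem _ fun j _ ↦ Submodule.smul_mem _ _ (classVec_mem (j : truncIdx N))

/-- `F` of the clump vector is the `B`-weighted sum of the `F`-transforms of the mirror-pair vectors (class sizes as weights). -/
theorem F_clumpVec (S : Finset (truncIdx N)) (B : S → ℂ) (u : ℝ) :
    F N (clumpVec S B) u = ∑ j : S, (B j * (fib (j : truncIdx N)).card) * F N (pairVec (j : truncIdx N)) u := by
  rw [clumpVec, F_finset_sum]
  refine Finset.sum_congr rfl fun j _ ↦ ?_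
  rw [F_classVec, mul_assoc]

/-- The pairing of the clump vector: cross terms vanish (G6.2), diagonal terms are `−2 m_j |B_j|²`. -/
theorem re_pairing_clumpVec (S : Finset (truncIdx N)) (B : S → ℂ)
    (hre : ∀ j : S, 1 / 2 < ((j : truncIdx N) : ZeroIdx).val.re)
    (hinj : ∀ j l : S, ((j : truncIdx N) : ZeroIdx).val = ((l : truncIdx N) : ZeroIdx).val → j = l) :
    (pairing N (clumpVec S B) (clumpVec S B)).re = -2 * ∑ j : S, ‖B j‖ ^ 2 * (fib (j : truncIdx N)).card := by
  rw [clumpVec, pairing_finset_sum]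
  have hdiag : ∀ j : S, ∑ l : S, conj (B j) * B l * pairing N (classVec (j : truncIdx N)) (classVec (l : truncIdx N))
      = ((-2 * (‖B j‖ ^ 2 * (fib (j : truncIdx N)).card) : ℝ) : ℂ) := by
    intro j
    rw [Finset.sum_eq_single j (fun l _ hlj ↦ ?_) (fun h ↦ absurd (Finset.mem_univ j) h),
      pairing_classVec (show ((j : truncIdx N) : ZeroIdx).OffLine from (hre j).ne'), Complex.conj_mul']
    · push_cast
      ring
    · rw [pairing_classVec_classVec_eq_zero (hre j) (hre l) (fun h ↦ hlj (hinj l j h.symm)), mul_zero]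
  rw [Finset.sum_congr rfl fun j _ ↦ hdiag j]
  rw [← Complex.ofReal_sum] -- may need adjusting
  rw [Complex.ofReal_re, Finset.mul_sum]

/-- **(T6b′) CLUMP SCREENING THEOREM** (kernel; unconditional).  Let `S ⊆ Γ_N` be a set of slots carrying PAIRWISE DIFFERENT zeros,
all RIGHT of the critical line, each of class multiplicity `#fib j ≤ M`, all within the unit disc about `½ + i t₀`
(`|ρ_j − ½ − i t₀| ≤ 1`), with `#S > d ≥ 1`.  Then `𝒦_{[−1,1]}(Γ_N)` has a real eigenvalue in `(−c, 0)` for every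
`c > 4 · #S · M · ε_d²`, `ε_d = (d+1)/(d!·d)`.  MECHANISM: rank–nullity gives amplitudes killing the first `d` Taylor coefficients of
the synthesised function `e^{−it₀u} Σ_j m_j B_j (e^{−w_j u} − e^{w̄_j u})`, whose cost on `[−1,1]` is then `≤ 8 ε_d² (Σ|m_j B_j|)²`,
while its pairing is `−2 Σ m_j |B_j|² < 0` EXACTLY (different classes are pairing-orthogonal); the screening criterion (K2-mult)
converts the ratio into a negative eigenvalue close to `0`.  No frame theory, no density, no gap hypothesis. [new] -/
theorem clump_negRoot {S : Finset (truncIdx N)} {d M : ℕ} (hd : 0 < d) (hS : d < S.card) (t₀ : ℝ)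
    (hre : ∀ j ∈ S, 1 / 2 < (j : ZeroIdx).val.re)
    (hinj : ∀ j ∈ S, ∀ l ∈ S, (j : ZeroIdx).val = (l : ZeroIdx).val → j = l)
    (hM : ∀ j ∈ S, (fib j).card ≤ M)
    (hw : ∀ j ∈ S, ‖(j : ZeroIdx).val - 1 / 2 - I * t₀‖ ≤ 1)
    {c : ℝ} (hc : 4 * S.card * M * tailConst d ^ 2 < c) :
    ∃ μ ∈ (truncKMat (Icc (-1 : ℝ) 1) N).charpoly.roots, μ.im = 0 ∧ -c < μ.re ∧ μ.re < 0 := by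
  obtain ⟨B, hB0, hB⟩ := exists_ker_taylorMap S t₀ hS
  have hre' : ∀ j : S, 1 / 2 < ((j : truncIdx N) : ZeroIdx).val.re := fun j ↦ hre j j.2
  have hw' : ∀ j : S, ‖wOf t₀ (j : truncIdx N)‖ ≤ 1 := fun j ↦ hw j j.2
  have hinj' : ∀ j l : S, ((j : truncIdx N) : ZeroIdx).val = ((l : truncIdx N) : ZeroIdx).val → j = l :=
    fun j l h ↦ Subtype.ext (hinj j j.2 l l.2 h)
  set P : ℝ := ∑ j : S, ‖B j‖ ^ 2 * (fib (j : truncIdx N)).card with hP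
  have hpair : (pairing N (clumpVec S B) (clumpVec S B)).re = -2 * P := re_pairing_clumpVec S B hre' hinj'
  have hPpos : 0 < P := by
    obtain ⟨j, hj⟩ : ∃ j, B j ≠ 0 := by
      by_contra h
      exact hB0 (funext fun j ↦ not_ne_iff.1 (not_exists.1 h j))
    have hk := fib_card_pos (j : truncIdx N)
    have h1 : 0 < ‖B j‖ ^ 2 * (fib (j : truncIdx N)).card := by positivity
    exact h1.trans_le (Finset.single_le_sum (f := fun l : S ↦ ‖B l‖ ^ 2 * ((fib (l : truncIdx N)).card : ℝ))
      (fun l _ ↦ by positivity) (Finset.mem_univ j))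
  -- the amplitudes of the synthesised function are `C_j = m_j B_j`
  set C : S → ℂ := fun j ↦ B j * (fib (j : truncIdx N)).card with hCdef
  have hC : ∀ m : Fin d, ∑ j : S, C j * tcoeff t₀ (j : truncIdx N) m = 0 := hB
  have hcost : ∫ u in Icc (-1 : ℝ) 1, ‖F N (clumpVec S B) u‖ ^ 2 ≤ 8 * tailConst d ^ 2 * (∑ j : S, ‖C j‖) ^ 2 :=
    cost_le_of_taylor hd hC hw' (F_clumpVec S B)
  have hCS : (∑ j : S, ‖C j‖) ^ 2 ≤ S.card * ∑ j : S, ‖C j‖ ^ 2 := by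
    have h := sq_sum_le_card_mul_sum_sq (s := (Finset.univ : Finset S)) (f := fun j ↦ ‖C j‖)
    simpa [Finset.card_univ, Fintype.card_coe] using h
  have hCP : ∑ j : S, ‖C j‖ ^ 2 ≤ M * P := by
    rw [hP, Finset.mul_sum]
    refine Finset.sum_le_sum fun j _ ↦ ?_
    have hk : ((fib (j : truncIdx N)).card : ℝ) ≤ M := by exact_mod_cast hM j j.2
    rw [hCdef, norm_mul, Complex.norm_natCast, mul_pow]
    calc ‖B j‖ ^ 2 * ((fib (j : truncIdx N)).card : ℝ) ^ 2
        = (fib (j : truncIdx N)).card * (‖B j‖ ^ 2 * (fib (j : truncIdx N)).card) := by ring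
      _ ≤ M * (‖B j‖ ^ 2 * (fib (j : truncIdx N)).card) := by gcongr
  have hcpos : 0 < c := lt_of_le_of_lt (by positivity) hc
  refine exists_negRoot_of_screening_mult one_pos hcpos (clumpVec_mem S B) ?_
  rw [hpair]
  calc ∫ u in Icc (-1 : ℝ) 1, ‖F N (clumpVec S B) u‖ ^ 2 ≤ 8 * tailConst d ^ 2 * (∑ j : S, ‖C j‖) ^ 2 := hcost
    _ ≤ 8 * tailConst d ^ 2 * (S.card * (M * P)) := by
        gcongr
        exact hCS.trans (by gcongr)
    _ = (4 * S.card * M * tailConst d ^ 2) * (2 * P) := by ring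
    _ < c * (2 * P) := mul_lt_mul_of_pos_right hc (by linarith)
    _ = c * -(-2 * P) := by ring

end Summit.RiemannHypothesis.RiemannHypothesis.Theorems.Splittings.BombieriTruncClump
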